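import Summits.ResolutionOfSingularities.ResolutionOfSingularities.Theorems.ValuativeLuAlphaPTorsorLogPrincipalizationLowDim
import Summits.ResolutionOfSingularities.ResolutionOfSingularities.Theorems.ValuativeLuAlphaPTorsorBirationalExit
import Summits.ResolutionOfSingularities.ResolutionOfSingularities.Theorems.ValuativeLuAlphaPTorsorFinalFormExits
import Summits.ResolutionOfSingularities.ResolutionOfSingularities.Theorems.ValuativeLuAlphaPTorsorMonogenicExit
import Summits.ResolutionOfSingularities.ResolutionOfSingularities.Theorems.ValuativeLuAlphaPTorsorToroidalExit
import Literature.AlgebraicGeometry.Resolution.ArithmeticalThreefolds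

/-!
# `LuAlphaPTorsor` along valuations centred in codimension `≤ 1`, and for monogenic torsors

Crux `Valuative.LuAlphaPTorsor` (item `stmt-ResolutionOfSingularities-0641`), line
`pfaff-line-log-final-forms`: the line's composition `LuAlphaPTorsor_of`
(`Cruxes/LuAlphaPTorsor/Lines/pfaff-line-log-final-forms.lean`) run with the PROVED cases of the
one open stub `stub_logPrincipalization` (file `…LogPrincipalizationLowDim.lean`) in place of the
stub. Unconditional consequences, for every prime `p` and EVERY ground field `k` of
characteristic `p`:

* `luAlphaPTorsor_of_ringKrullDim_le_one` — the crux holds whenever the local ring of the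
  regular base `A₀` at the centre of the valuation has dimension `≤ 1` (the centre is the generic
  point or a codimension-one point of `Spec A₀`; no restriction on `trdeg_k K`, on the rank of the
  valuation or on `[k : k^p]`).
* `luAlphaPTorsor_of_isUnit_derivation` — the crux holds whenever some `ℤ`-derivation of that
  local ring takes `t^p` to a unit (the monogenic exit fires at once: `A := A₀[t, …]`).

What is NOT here: base dimension `≥ 2` at the centre, which needs blow-ups of the base
(`stub_logPrincipalization` = monomialization of `t^p` modulo `p`-th powers along `ν`; classical
in dimension `2`, Cossart–Piltant-strength in dimension `3`, open from dimension `4` on).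
-/

set_option linter.dupNamespace false

namespace Summit.ResolutionOfSingularities.ResolutionOfSingularities.Theorems.PfaffLine

open IsLocalRing

/-- `A₀[t] ≤ A₁[t]` when `A₀ ≤ A₁`. [folklore] -/
theorem adjoin_insert_mono' {k K : Type} [Field k] [Field K] [Algebra k K]
    {A₀ A₁ : Subalgebra k K} (hle : A₀ ≤ A₁) (t : K) :
    Algebra.adjoin k (insert t (A₀ : Set K)) ≤ Algebra.adjoin k (insert t (A₁ : Set K)) :=
  Algebra.adjoin_mono (Set.insert_subset_insert hle)

/-- **`LuAlphaPTorsor` along valuations whose centre on the regular base has codimension `≤ 1`.**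
For `k` of characteristic `p`, `O` a valuation ring of `K ⊇ k`, `A₀ ⊆ O` finitely generated and
regular at the centre, `t^p ∈ A₀` with `Frac (A₀[t]) = K`: if the local ring of `A₀` at the
centre has Krull dimension `≤ 1`, then some finitely generated `A ⊇ A₀[t]` inside `O` with
`Frac A = K` is regular at the centre. Proof: the line `pfaff-line-log-final-forms` — in
dimension `≤ 1` the log-content of `t^p` is already monomial
(`logPrincipalization_of_ringKrullDim_le_one`), then `stub_pthPowerModMonomial`,
`stub_finalFormExits` and the three exits. [folklore] -/
theorem luAlphaPTorsor_of_ringKrullDim_le_one :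
    ∀ p : ℕ, p.Prime → ∀ (k K : Type) [Field k] [CharP k p] [Field K] [Algebra k K] (O : ValuationSubring K) (A₀ : Subalgebra k K) (h₀ : A₀.toSubring ≤ O.toSubring) (t : K), A₀.FG → t ^ p ∈ A₀ → IsFractionRing (Algebra.adjoin k (insert t (A₀ : Set K))) K → IsRegularLocalRing (Localization.AtPrime (Ideal.comap (Subring.inclusion h₀) (IsLocalRing.maximalIdeal O))) → ringKrullDim (Localization.AtPrime (Ideal.comap (Subring.inclusion h₀) (IsLocalRing.maximalIdeal O))) ≤ 1 → ∃ (A : Subalgebra k K) (h : A.toSubring ≤ O.toSubring), A₀ ≤ A ∧ t ∈ A ∧ A.FG ∧ IsFractionRing A K ∧ IsRegularLocalRing (Localization.AtPrime (Ideal.comap (Subring.inclusion h) (IsLocalRing.maximalIdeal O))) := by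
  intro p hp k K _ _ _ _ O A₀ h₀ t hfg htp hfr hreg hdim
  by_cases hpow : ∃ c : Localization.AtPrime (Ideal.comap (Subring.inclusion h₀)
      (IsLocalRing.maximalIdeal O)), algebraMap A₀.toSubring (Localization.AtPrime
        (Ideal.comap (Subring.inclusion h₀) (IsLocalRing.maximalIdeal O))) ⟨t ^ p, htp⟩ = c ^ p
  · exact stub_birationalExit p hp k K O A₀ h₀ t hfg htp hfr hreg hpow
  · push Not at hpow
    obtain ⟨A₁, h₁, hle, hA₁fg, hA₁reg, d, u, E, M, hspan, hdimd, hcontent⟩ :=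
      logPrincipalization_of_ringKrullDim_le_one p hp k K O A₀ h₀ t hfg htp hreg hdim hpow
    have hfr₁ : IsFractionRing (Algebra.adjoin k (insert t (A₁ : Set K))) K :=
      Literature.AlgebraicGeometry.Resolution.isFractionRing_of_le (adjoin_insert_mono' hle t) hfr
    have htp₁ : t ^ p ∈ A₁ := hle htp
    obtain ⟨c, hc⟩ := stub_pthPowerModMonomial p hp k K O A₁ h₁ hA₁fg hA₁reg _ d u E M
      ⟨hspan, hdimd⟩ hcontent.le
    rcases stub_finalFormExits p hp k K O A₁ h₁ hA₁fg hA₁reg _ c d u E M ⟨hspan, hdimd⟩ hcontent hc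
      with hPR | hT
    · rcases hPR with hP | hR
      · obtain ⟨A, h, hle₁, ht, hAfg, hAfr, hAreg⟩ :=
          stub_birationalExit p hp k K O A₁ h₁ t hA₁fg htp₁ hfr₁ hA₁reg hP
        exact ⟨A, h, hle.trans hle₁, ht, hAfg, hAfr, hAreg⟩
      · obtain ⟨A, h, hle₁, ht, hAfg, hAfr, hAreg⟩ :=
          stub_monogenicExit p hp k K O A₁ h₁ t hA₁fg htp₁ hfr₁ hA₁reg hR
        exact ⟨A, h, hle.trans hle₁, ht, hAfg, hAfr, hAreg⟩
    · obtain ⟨A, h, hle₁, ht, hAfg, hAfr, hAreg⟩ :=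
        stub_toroidalExit p hp k K O A₁ h₁ t hA₁fg htp₁ hfr₁ hA₁reg hT
      exact ⟨A, h, hle.trans hle₁, ht, hAfg, hAfr, hAreg⟩

/-- **`LuAlphaPTorsor` for monogenic torsors.** In the setting of the crux, if some
`ℤ`-derivation of the local ring of the base at the centre takes `t^p` to a UNIT, the monogenic
exit applies at once (`t^p - 0^p = 1^p · t^p`): some finitely generated `A ⊇ A₀[t]` inside `O`
with `Frac A = K` is regular at the centre (Stacks 07PG: `R[T]/(T^p - a)` is regular when a
derivative of `a` is a unit). [folklore] -/
theorem luAlphaPTorsor_of_isUnit_derivation :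
    ∀ p : ℕ, p.Prime → ∀ (k K : Type) [Field k] [CharP k p] [Field K] [Algebra k K] (O : ValuationSubring K) (A₀ : Subalgebra k K) (h₀ : A₀.toSubring ≤ O.toSubring) (t : K), A₀.FG → ∀ (htp : t ^ p ∈ A₀), IsFractionRing (Algebra.adjoin k (insert t (A₀ : Set K))) K → IsRegularLocalRing (Localization.AtPrime (Ideal.comap (Subring.inclusion h₀) (IsLocalRing.maximalIdeal O))) → (∃ δ : Derivation ℤ (Localization.AtPrime (Ideal.comap (Subring.inclusion h₀) (IsLocalRing.maximalIdeal O))) (Localization.AtPrime (Ideal.comap (Subring.inclusion h₀) (IsLocalRing.maximalIdeal O))), IsUnit (δ (algebraMap A₀.toSubring (Localization.AtPrime (Ideal.comap (Subring.inclusion h₀) (IsLocalRing.maximalIdeal O))) ⟨t ^ p, htp⟩))) → ∃ (A : Subalgebra k K) (h : A.toSubring ≤ O.toSubring), A₀ ≤ A ∧ t ∈ A ∧ A.FG ∧ IsFractionRing A K ∧ IsRegularLocalRing (Localization.AtPrime (Ideal.comap (Subring.inclusion h) (IsLocalRing.maximalIdeal O))) := by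
  intro p hp k K _ _ _ _ O A₀ h₀ t hfg htp hfr hreg hδ
  obtain ⟨δ, hδu⟩ := hδ
  refine stub_monogenicExit p hp k K O A₀ h₀ t hfg htp hfr hreg ⟨0, 1, _, δ, one_ne_zero, ?_, hδu⟩
  rw [zero_pow hp.ne_zero, sub_zero, one_pow, one_mul]

end Summit.ResolutionOfSingularities.ResolutionOfSingularities.Theorems.PfaffLine
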